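import Summits.Ventures.QEC.Census.BB.BB784RankXm1
import Summits.Ventures.QEC.Census.BB.BB784RankXm2
import Summits.Ventures.QEC.Census.BB.BB784RankXm3
import Summits.Ventures.QEC.Census.BB.BB784RankXm4
import Summits.Ventures.QEC.Census.BB.BB784RankXs
import Summits.Ventures.QEC.Census.RankRREFAppend
import Summits.Ventures.QEC.Census.BB.BB784RankXb
import Summits.Ventures.QEC.Census.RankPivotChunks
import HarnessLib

set_option maxRecDepth 200000

/-!
# `[[784,24,≤24]]` (BB.bb784): `rank₂ H^X = 380`, chunked masks-only RREF certificate — part c (pivot columns, indices 192…379; assembly)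

`BB.bb784` = `QC(x²⁶+y⁶+y⁸, y⁷+x⁹+x²⁰)` on `ℤ₂₈ × ℤ₁₄` [BravyiEtAl2024, §5] (arXiv:2308.07915 chunk p0011 L41–47); rows `BBRows.rowsX la lb`
and pivots `pivX` from `Census/BB/BB784Data.lean`, masks/reduced rows in chunks from `BB784RedX.lean`. Parts m1–m4: every reduced row re-derived from its mask (`masksOKL`, one chunk of 95 per file); part s: every check row re-assembled from
its pivot bits (`redSelL`). Parts b/c: unit pivot columns over index ranges (`List.range'` chunks, `decide +kernel` each); part c assembles
`pivotsOK` (`Census/RankPivotChunks.pivotsOK_of_forall`) and the rank (`Census/RankRREFAppend.rank_rowMatrix_of_parts`), transported to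
`BB.bb784.HXFlat` along `rowsX_obj`. Tier KERNEL; axioms standard; no `native_decide`. HONEST FRAMING: a rank only.
-/

namespace Summit.Ventures.QEC.Census.BB784

open Matrix Literature.InformationTheory.QuantumCodes Summit.Ventures.QEC.Census BBRows

/-- Pivot chunk 5: for indices `i ∈ [192, 240)`, pivot `pivX[i] < 784` and column `pivX[i]` of the reduced rows is the unit vector `e_i` (`decide +kernel`). -/
theorem pivXc5_ok : ((List.range' 192 48).all fun i => ((pivX.getD i 0 < 784 : Bool) && (colMask (rX1 ++ rX2 ++ rX3 ++ rX4) (pivX.getD i 0) == 2 ^ i))) = true := by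
  decide +kernel

/-- Pivot chunk 6: for indices `i ∈ [240, 288)`, pivot `pivX[i] < 784` and column `pivX[i]` of the reduced rows is the unit vector `e_i` (`decide +kernel`). -/
theorem pivXc6_ok : ((List.range' 240 48).all fun i => ((pivX.getD i 0 < 784 : Bool) && (colMask (rX1 ++ rX2 ++ rX3 ++ rX4) (pivX.getD i 0) == 2 ^ i))) = true := by
  decide +kernel

/-- Pivot chunk 7: for indices `i ∈ [288, 336)`, pivot `pivX[i] < 784` and column `pivX[i]` of the reduced rows is the unit vector `e_i` (`decide +kernel`). -/
theorem pivXc7_ok : ((List.range' 288 48).all fun i => ((pivX.getD i 0 < 784 : Bool) && (colMask (rX1 ++ rX2 ++ rX3 ++ rX4) (pivX.getD i 0) == 2 ^ i))) = true := by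
  decide +kernel

/-- Pivot chunk 8: for indices `i ∈ [336, 380)`, pivot `pivX[i] < 784` and column `pivX[i]` of the reduced rows is the unit vector `e_i` (`decide +kernel`). -/
theorem pivXc8_ok : ((List.range' 336 44).all fun i => ((pivX.getD i 0 < 784 : Bool) && (colMask (rX1 ++ rX2 ++ rX3 ++ rX4) (pivX.getD i 0) == 2 ^ i))) = true := by
  decide +kernel

/-- All 380 reduced rows re-derived from their masks: the four chunks glued by `masksOKL_append`. -/
theorem masksX_ok : masksOKL (rowsX la lb) (rX1 ++ rX2 ++ rX3 ++ rX4) (mX1 ++ mX2 ++ mX3 ++ mX4) = true := by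
  rw [masksOKL_append (rowsX la lb) (rX1 ++ rX2 ++ rX3) (mX1 ++ mX2 ++ mX3) rX4 mX4 (by decide +kernel),
    masksOKL_append (rowsX la lb) (rX1 ++ rX2) (mX1 ++ mX2) rX3 mX3 (by decide +kernel),
    masksOKL_append (rowsX la lb) rX1 mX1 rX2 mX2 (by decide +kernel),
    maskX1_ok, maskX2_ok, maskX3_ok, maskX4_ok]
  rfl

/-- `|pivX| = 380`. -/
theorem pivX_length : pivX.length = 380 := by
  decide +kernel

/-- `|rX1 ++ rX2 ++ rX3 ++ rX4| = 380`. -/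
theorem redX_length : (rX1 ++ rX2 ++ rX3 ++ rX4).length = 380 := by
  decide +kernel

/-- **Unit pivot columns** (`pivotsOK`) assembled from the eight index-range chunks (`RankPivotChunks.pivotsOK_of_forall`). -/
theorem pivX_ok : pivotsOK 784 pivX (rX1 ++ rX2 ++ rX3 ++ rX4) = true :=
  pivotsOK_of_forall (pivX_length.trans redX_length.symm) fun i hi => by
    rw [pivX_length] at hi
    rcases Nat.lt_or_ge i 48 with h1 | h1
    · exact forall_of_all_range' pivXc1_ok i (Nat.zero_le _) (by omega)
    rcases Nat.lt_or_ge i 96 with h2 | h2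
    · exact forall_of_all_range' pivXc2_ok i h1 (by omega)
    rcases Nat.lt_or_ge i 144 with h3 | h3
    · exact forall_of_all_range' pivXc3_ok i h2 (by omega)
    rcases Nat.lt_or_ge i 192 with h4 | h4
    · exact forall_of_all_range' pivXc4_ok i h3 (by omega)
    rcases Nat.lt_or_ge i 240 with h5 | h5
    · exact forall_of_all_range' pivXc5_ok i h4 (by omega)
    rcases Nat.lt_or_ge i 288 with h6 | h6
    · exact forall_of_all_range' pivXc6_ok i h5 (by omega)
    rcases Nat.lt_or_ge i 336 with h7 | h7
    · exact forall_of_all_range' pivXc7_ok i h6 (by omega)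
    · exact forall_of_all_range' pivXc8_ok i h7 (by omega)

set_option maxHeartbeats 2000000 in -- large index types met by the rewrite
set_option maxRecDepth 200000 in
/-- **`rank₂ H^X (BB.bb784) = 380`** (CERTIFIED, kernel tier): the four conjuncts of the masks-only RREF certificate, proved chunk-wise,
assembled by `rank_rowMatrix_of_parts` and transported along `rowsX_obj`. -/
theorem rank_HXFlat : BB.bb784.HXFlat.rank = 380 := by
  rw [← rowsX_obj]
  exact rank_rowMatrix_of_parts (masks := mX1 ++ mX2 ++ mX3 ++ mX4) (by rw [pivX_length]; decide) pivX_ok masksX_ok selX_ok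

end Summit.Ventures.QEC.Census.BB784
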